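import Mathlib
import Summits.QuantumFields.YangMills.Theorems.BalabanUVNodesN15BackgroundLayerByName
import Summits.QuantumFields.YangMills.Theorems.BalabanUVNodesN15BackgroundEntries
import HarnessLib

/-!
# Route «BalabanUVNodes» (cluster K4 «SpineRates»), Track-A DAG node N15 = spine estimate NE2, BACKGROUND LAYER — ALL FOUR (3.42) ENTRIES OF THE
# BACKGROUND-DEPENDENT PAIR CONSTRUCTED: the `G∇*` entry as the source step `(1 − G∘M_c)⁻¹S`, the `∇G` ∕ `ΔG` entries as derived objects
# `D + (D∘M_c)∘X(c)`, and their η-defect majorants under the guard (the by-name readout with ONLY the `U ≡ 1` layer displayed is part A4)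

Cell `pub-ymgap`, seat `pub-ymgap-dag-n15-b` (generation g5; FIRST-MISSING-ESTIMATE, HUMAN RULING D-0062; chair R424 venue; ROSTER-D0062 l.26).
`bears_on: R4∕N15`.  Filed `--supports stmt-QuantumFields-19351` (helper).  Imports parts A1∕A2 `…N15.BackgroundLayer` (`bgProp`, `hasMaj_idef_bgProp`,
`coeffBg`, `bgInstance`, `hasMaj_entry0_background`, `bgConst`) and g0's file 7 `…N15.BackgroundStep` (`idef_source_step_majorant`,
`idef_derived_entry_majorant_flat`) BY NAME; nothing in the tree is modified.

THE POINT.  Part A2's `ne2PlusOperator_background` displays entries 1–3 (`∇_UG`, `G∇*_U`, `Δ_UG` of (3.42) p. 397) as the consumer's operators with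
majorant hypotheses.  Here they are CONSTRUCTED from the `U ≡ 1` layer and the coefficient, following g0 file 7 (*«each entry is its own object with its own
(3.42) kernel (King's convention, (3.73) p. 665) … NOT differentiating a pulled-back function»*): for the background-dependent `X(c) = (1 − G∘M_c)⁻¹G`
(A1's `bgProp`), `PX(c) = PG + (PG∘M_c)∘X(c)` for every coarse operation `P` (`comp_bgProp`), so the `∇G`∕`ΔG` entries are `bgDerived G D c := D + (D∘M_c)∘X(c)`
with `D = PG` the `U ≡ 1` DERIVED PIECE; and `X(c)∘Q = (1 − G∘M_c)⁻¹(G∘Q)` (`bgProp_comp`), so the `G∇*` entry is the SOURCE STEP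
`bgSource G S c := (1 − G∘M_c)⁻¹S` with `S = G∇*` the `U ≡ 1` SOURCE PIECE.  Because the perturbation species is ZEROTH order (`M_c`), the sandwiched
coefficient defect `D′∘𝔇(M_{c′}, M_{c̄})∘X` needs only the plain majorant of the left factor `D′` (A1's `hasMaj_sandwich_blockAvg`) — NO (3.44)-shaped
adjoint-derivative entry (that entry is needed for the first-order species, parts 4∕11∕17).

CONTENTS ([folklore]: linear algebra + the lineage's lemmas BY NAME; 4 defs).
* §1 `bgSource`, `bgSource_fix` ((3.65) with source `S`, BY CONSTRUCTION), `bgProp_comp` (`X(c)∘Q = bgSource G (G∘Q) c`), `bgDerived`, `comp_bgProp`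
  (`P∘X(c) = bgDerived G (P∘G) c`) — the interpretation lemmas.
* §2 `hasMaj_bgSource` (Neumann with decay for any source `S ≤ β·e^{−δd}`), `hasMaj_mulOp_bgSource`; **`hasMaj_idef_bgSource`** (ENTRY 2's defect:
  file 7 `idef_source_step_majorant` with every binder but the `U ≡ 1` layer discharged — same constant polynomial as entry 0) and **`hasMaj_idef_bgDerived`**
  (ENTRIES 1∕3: file 7 `idef_derived_entry_majorant_flat`, the entry-0 defect supplied by A1's `hasMaj_idef_bgProp`).
* §3 Under the guard, letters READ OFF `Reg335`: `hasMaj_entry2_background` (`≤ bgConst·θ·e^{−(δ−σ)d}`), `hasMaj_entry13_background`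
  (`≤ bgConst1·θ·e^{−(δ−σ)d}`, `bgConst1 = m₀c_r + m₀c_r(c₃₅a₀)(2β) + bgConst∕2 + β(c₃₅a₀)(2β)c_r`).
* SEQUEL (part A4 `BalabanUVNodesN15BackgroundLayerFull`): `bgOps4` (ALL FOUR ENTRIES CONSTRUCTED), per-index `EtaRateIneq342` and `NE2PlusOperator` BY NAME
  whose only displayed hypotheses are the NE2⁰ operator layer's (decaying majorants of `G, G′, S, D₁′, D₃′` and the four η-defects with the rate number
  `θ`) — what -a parts 15∕16∕23 prove on the unit torus (`hasMaj_entry0…3`) plus plain majorants.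

HONEST FRAMING ∕ LIMITS.  Bookkeeping + finite-dimensional linear algebra over hypothesis-shaped data; the `U ≡ 1` layer is DISPLAYED (not proved here);
scalar coefficients, zeroth-order species, linearised transport, sites of physical size `≥ 1`; the guard is the datum's `M` (live iff the consumer's family
has unbounded `M`); nothing about Bałaban's `G(U)` of [B6]∕[B9] is asserted.  NE2⁺ NOT PRINTED, NOT
proved; count-neutral (typed 28∕28; nothing discharged); N15 NOT discharged; one finite lattice at fixed ε — NOT infinite volume, NOT OS on ℝ⁴, NOT a mass
gap, NOT Clay.
-/

noncomputable section

namespace Summit.QuantumFields.YangMills.BalabanUVNodes.N15.BackgroundLayer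

open Literature.MathematicalPhysics.QuantumFieldTheory.Balaban1983to89
open Literature.MathematicalPhysics.QuantumFieldTheory.Balaban1983to89.B11SectG (BlockNorm HasMaj hasMaj_comp hasMaj_comp_exp RowSum)
open Literature.MathematicalPhysics.QuantumFieldTheory.Balaban1983to89.T4EtaRate (PairedInstance EtaRateIneq342 NE2PlusOperator rateFactor)
open Literature.MathematicalPhysics.QuantumFieldTheory.Balaban1983to89.T4EtaRateDefect (idef rateWeight slowWeight_const)
open Literature.MathematicalPhysics.QuantumFieldTheory.Balaban1983to89.T4EtaRateCoeffDefect (pull diagK diagK_nonneg FibreOsc blockAvg hasMaj_mulOp)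
open Literature.MathematicalPhysics.QuantumFieldTheory.Balaban1983to89.B9SectDWeightedNeumann (WRow wrow_of_exp neumann_majorant_wrow)
open Literature.MathematicalPhysics.QuantumFieldTheory.Balaban1983to89.B6RandomWalk (Triangle254)
open Literature.MathematicalPhysics.QuantumFieldTheory.Balaban1983to89.B6Prop26Gluing (mulOp)
open Literature.MathematicalPhysics.QuantumFieldTheory.Balaban1983to89.B9SectDSup (inv_one_sub_le_two)
open Summit.QuantumFields.YangMills.BalabanUVNodes.N15.DerivDefect (sum_diagK_mul exists_const_hasMaj_ofBlocks)
open Summit.QuantumFields.YangMills.BalabanUVNodes.N15.BackgroundModel (neumannSol kappa_ofBlocks)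
open Summit.QuantumFields.YangMills.BalabanUVNodes.N15.BackgroundStep (idef_source_step_majorant idef_derived_entry_majorant_flat)
open Summit.QuantumFields.YangMills.BalabanUVNodes.N15.OperatorReadout (opGeo opFamily opGeo_len rateFactor_opGeo etaRateIneq342_of_hasMaj)

/-! ## §1 The constructed source-step and derived objects, with their interpretation -/

section Objects

variable {X : Type} [Fintype X] [DecidableEq X]

/-- THE SOURCE STEP `Z = (1 − G∘M_c)⁻¹S` of a `U ≡ 1` piece `G`, a `U ≡ 1` SOURCE PIECE `S` (intended: `G∇*`) and a coefficient `c` — entry 2's object.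
[cite: Balaban1985BackgroundPropagators, (3.64)–(3.65) pp.402–403 (shape)] -/
def bgSource (G S : (X → ℝ) →ₗ[ℝ] (X → ℝ)) (c : X → ℝ) : (X → ℝ) →ₗ[ℝ] (X → ℝ) :=
  (neumannSol (LinearMap.toMatrix' (G ∘ₗ mulOp c)) (LinearMap.toMatrix' S)).mulVecLin

/-- (3.65) with the source `S`, BY CONSTRUCTION: `Z = S + (G∘M_c)∘Z`. [cite: Balaban1985BackgroundPropagators, (3.65) p.403 (shape)] -/
theorem bgSource_fix {G S : (X → ℝ) →ₗ[ℝ] (X → ℝ)} {c : X → ℝ} (hunit : IsUnit (1 - LinearMap.toMatrix' (G ∘ₗ mulOp c))) :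
    bgSource G S c = S + (G ∘ₗ mulOp c) ∘ₗ bgSource G S c := by
  unfold bgSource
  conv_lhs => rw [neumannSol_fix_of_isUnit hunit]
  rw [Matrix.mulVecLin_add, Matrix.mulVecLin_mul, mulVecLin_toMatrix', mulVecLin_toMatrix']

/-- INTERPRETATION: `X(c)∘Q` IS the source step with source `G∘Q` (so `X∇* = (1 − G∘M_c)⁻¹(G∇*)`). [folklore] -/
theorem bgProp_comp (G Q : (X → ℝ) →ₗ[ℝ] (X → ℝ)) (c : X → ℝ) : bgProp G c ∘ₗ Q = bgSource G (G ∘ₗ Q) c := by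
  unfold bgProp bgSource neumannSol
  conv_lhs => rw [← mulVecLin_toMatrix' Q]
  rw [← Matrix.mulVecLin_mul, LinearMap.toMatrix'_comp G Q, Matrix.mul_assoc]

/-- THE DERIVED OBJECT `Y = D + (D∘M_c)∘X(c)` of a `U ≡ 1` DERIVED PIECE `D` (intended: `∇G`, `ΔG`) — entries 1 and 3. [cite: King1986, Prop. 3.9 (3.73) p.665 (the derivative kernel as a separate kernel: shape)] -/
def bgDerived (G D : (X → ℝ) →ₗ[ℝ] (X → ℝ)) (c : X → ℝ) : (X → ℝ) →ₗ[ℝ] (X → ℝ) :=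
  D + (D ∘ₗ mulOp c) ∘ₗ bgProp G c

/-- INTERPRETATION: `P∘X(c)` IS the derived object of the piece `P∘G` (so `∇X(c) = ∇G + (∇G∘M_c)∘X(c)`), by (3.65). [folklore] -/
theorem comp_bgProp {G : (X → ℝ) →ₗ[ℝ] (X → ℝ)} {c : X → ℝ} (P : (X → ℝ) →ₗ[ℝ] (X → ℝ))
    (hunit : IsUnit (1 - LinearMap.toMatrix' (G ∘ₗ mulOp c))) : P ∘ₗ bgProp G c = bgDerived G (P ∘ₗ G) c := by
  unfold bgDerived
  conv_lhs => rw [bgProp_fix hunit]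
  rw [LinearMap.comp_add]
  rfl

end Objects

/-! ## §2 Majorants of the source step, and the η-defects of entries 2 and 1∕3 -/

section Majorants

variable {X X' : Type} [Fintype X] [Fintype X'] [DecidableEq X] [DecidableEq X'] {g : B6.Geometry} (blk : X → g.Site) (π : X' → X)

/-- NEUMANN WITH DECAY FOR ANY SOURCE: `S ≤ β·e^{−δd}`, `G ≤ β·e^{−δd}`, `|c| ≤ r`, `q = β·r·c_r < 1` ⟹ `bgSource G S c ≤ β(1 − q)⁻¹·e^{−ρd}` (`ρ + σ ≤ δ`).
[cite: Balaban1985BackgroundPropagators, (3.64) p.403 (mechanism); Balaban1984PropagatorsII, (2.52)–(2.56) pp.232–233] -/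
theorem hasMaj_bgSource (htri : Triangle254 g) (hd : ∀ a b : g.Site, 0 ≤ g.dist a b) {σ cr : ℝ} (hrow : RowSum g σ cr) (hσ : 0 ≤ σ) {ρ δ β r : ℝ}
    (hρ : 0 ≤ ρ) (hρδ : ρ + σ ≤ δ) (hβ : 0 ≤ β) (hr : 0 ≤ r) {G S : (X → ℝ) →ₗ[ℝ] (X → ℝ)} {c : X → ℝ}
    (hG : HasMaj (BlockNorm.ofBlocks g blk) (BlockNorm.ofBlocks g blk) G (fun y y' => β * Real.exp (-(δ * g.dist y y'))))
    (hS : HasMaj (BlockNorm.ofBlocks g blk) (BlockNorm.ofBlocks g blk) S (fun y y' => β * Real.exp (-(δ * g.dist y y'))))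
    (hc : ∀ x, |c x| ≤ r) (hq : β * r * cr < 1) :
    HasMaj (BlockNorm.ofBlocks g blk) (BlockNorm.ofBlocks g blk) (bgSource G S c)
      (fun y y' => β * (1 - β * r * cr)⁻¹ * Real.exp (-(ρ * g.dist y y'))) := by
  have hσδ : σ ≤ δ := by linarith
  have hfix := bgSource_fix (S := S) (isUnit_step blk hd hrow hσδ hβ hr hG hc hq)
  have hK := hasMaj_step blk hβ hr hG hc
  have hwrow : WRow g ρ (fun y y' => β * r * Real.exp (-(δ * g.dist y y'))) (β * r * cr) := wrow_of_exp hd hrow (mul_nonneg hβ hr) hρδ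
  have hS' : HasMaj (BlockNorm.ofBlocks g blk) (BlockNorm.ofBlocks g blk) S (fun y y' => β * Real.exp (-(ρ * g.dist y y'))) :=
    hS.mono fun a b => mul_le_mul_of_nonneg_left (Real.exp_le_exp.mpr (by nlinarith [hd a b])) hβ
  obtain ⟨M₀, hM₀, hap⟩ := exists_const_hasMaj_ofBlocks (g := g) blk blk (bgSource G S c)
  have hq1 : (BlockNorm.ofBlocks g blk).κ * (β * r * cr) < 1 := by rw [kappa_ofBlocks, one_mul]; exact hq
  have key := neumann_majorant_wrow htri hd hρ (fun _ _ => mul_nonneg (mul_nonneg hβ hr) (Real.exp_nonneg _)) hwrow hβ hM₀ hK hS' hfix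
    hap hq1
  refine key.mono fun a b => le_of_eq ?_
  rw [kappa_ofBlocks, one_mul]

/-- The coarse `M_c∘Z ≤ r·β(1 − q)⁻¹·e^{−ρd}`. [cite: Balaban1985BackgroundPropagators, (3.63) p.402 (shape)] -/
theorem hasMaj_mulOp_bgSource (htri : Triangle254 g) (hd : ∀ a b : g.Site, 0 ≤ g.dist a b) {σ cr : ℝ} (hrow : RowSum g σ cr) (hσ : 0 ≤ σ)
    {ρ δ β r : ℝ} (hρ : 0 ≤ ρ) (hρδ : ρ + σ ≤ δ) (hβ : 0 ≤ β) (hr : 0 ≤ r) {G S : (X → ℝ) →ₗ[ℝ] (X → ℝ)} {c : X → ℝ}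
    (hG : HasMaj (BlockNorm.ofBlocks g blk) (BlockNorm.ofBlocks g blk) G (fun y y' => β * Real.exp (-(δ * g.dist y y'))))
    (hS : HasMaj (BlockNorm.ofBlocks g blk) (BlockNorm.ofBlocks g blk) S (fun y y' => β * Real.exp (-(δ * g.dist y y'))))
    (hc : ∀ x, |c x| ≤ r) (hq : β * r * cr < 1) :
    HasMaj (BlockNorm.ofBlocks g blk) (BlockNorm.ofBlocks g blk) (mulOp c ∘ₗ bgSource G S c)
      (fun y y' => r * (β * (1 - β * r * cr)⁻¹) * Real.exp (-(ρ * g.dist y y'))) := by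
  have hZ := hasMaj_bgSource blk htri hd hrow hσ hρ hρδ hβ hr hG hS hc hq
  have hM := hasMaj_mulOp (g := g) blk (m := fun _ => r) (fun _ => hr) fun x => hc x
  have key := hasMaj_comp hM hZ (fun _ _ => diagK_nonneg (fun _ => hr) _ _)
  refine key.mono fun a b => le_of_eq ?_
  rw [kappa_ofBlocks]
  simp only [one_mul]
  rw [sum_diagK_mul]
  ring

/-- **ENTRY 2 — THE η-DEFECT OF THE SOURCE STEP.**  Data of A1's `hasMaj_idef_bgProp` plus a `U ≡ 1` SOURCE PAIR `S`, `S′` with the coarse majorant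
`S ≤ β·e^{−δd}` and the defect `𝔇(S′, S) ≤ m_S·e^{−δd}` (no majorant of `S′` is needed: the fine object enters the Neumann bookkeeping only through its
fixed-point equation and the automatic a priori bound): `𝔇(bgSource G′ S′ c′, bgSource G S (blockAvg π c′)) ≤ (m_S c_r + m_G c_r·(rβ(1−q)⁻¹) + βo·β(1−q)⁻¹·c_r)(1−q)⁻¹·e^{−ρd}` — file 7
`idef_source_step_majorant` with binders (b)(c)(d)(f) DISCHARGED. [cite: Balaban1985BackgroundPropagators, Thm 3.1 (3.42) p.397 (third entry: shape); (3.63)–(3.65) pp.402–403 (mechanism)] -/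
theorem hasMaj_idef_bgSource (htri : Triangle254 g) (hd : ∀ a b : g.Site, 0 ≤ g.dist a b) {σ cr : ℝ} (hσ : 0 ≤ σ) (hcr : 0 ≤ cr)
    (hrow : RowSum g σ cr) {ρ δ β r o mG mS : ℝ} (hρ : 0 ≤ ρ) (hρδ : ρ + σ ≤ δ) (hβ : 0 ≤ β) (hr : 0 ≤ r) (ho : 0 ≤ o) (hmG : 0 ≤ mG) (hmS : 0 ≤ mS)
    {G S : (X → ℝ) →ₗ[ℝ] (X → ℝ)} {G' S' : (X' → ℝ) →ₗ[ℝ] (X' → ℝ)} {c' : X' → ℝ}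
    (hG : HasMaj (BlockNorm.ofBlocks g blk) (BlockNorm.ofBlocks g blk) G (fun y y' => β * Real.exp (-(δ * g.dist y y'))))
    (hG' : HasMaj (BlockNorm.ofBlocks g (blk ∘ π)) (BlockNorm.ofBlocks g (blk ∘ π)) G' (fun y y' => β * Real.exp (-(δ * g.dist y y'))))
    (hS : HasMaj (BlockNorm.ofBlocks g blk) (BlockNorm.ofBlocks g blk) S (fun y y' => β * Real.exp (-(δ * g.dist y y'))))
    (hDG : HasMaj (BlockNorm.ofBlocks g blk) (BlockNorm.ofBlocks g (blk ∘ π)) (idef (pull π) (pull π) G' G)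
      (fun y y' => mG * Real.exp (-(δ * g.dist y y'))))
    (hDS : HasMaj (BlockNorm.ofBlocks g blk) (BlockNorm.ofBlocks g (blk ∘ π)) (idef (pull π) (pull π) S' S)
      (fun y y' => mS * Real.exp (-(δ * g.dist y y'))))
    (hc' : ∀ x', |c' x'| ≤ r) (hosc : FibreOsc π c' (fun _ => o)) (hq : β * r * cr < 1) :
    HasMaj (BlockNorm.ofBlocks g blk) (BlockNorm.ofBlocks g (blk ∘ π))
      (idef (pull π) (pull π) (bgSource G' S' c') (bgSource G S (blockAvg π c')))
      (fun y y' => (mS * cr + 1 * (mG * cr) * (r * (β * (1 - β * r * cr)⁻¹)) * 1 + β * o * (β * (1 - β * r * cr)⁻¹) * cr) *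
        (1 - 1 * (β * r * cr))⁻¹ * Real.exp (-(ρ * g.dist y y')) * 1) := by
  have hσδ : σ ≤ δ := by linarith
  have hc : ∀ x, |blockAvg π c' x| ≤ r := abs_blockAvg_le π hr hc'
  have hq' : 0 < 1 - β * r * cr := by linarith
  have hAX : 0 ≤ β * (1 - β * r * cr)⁻¹ := mul_nonneg hβ (inv_nonneg.2 hq'.le)
  have hfix := bgSource_fix (S := S) (isUnit_step blk hd hrow hσδ hβ hr hG hc hq)
  have hfix' := bgSource_fix (S := S') (isUnit_step (blk ∘ π) hd hrow hσδ hβ hr hG' hc' hq)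
  have hK' := hasMaj_step (blk ∘ π) hβ hr hG' hc'
  have hwrow' : WRow g ρ (fun y y' => β * r * Real.exp (-(δ * g.dist y y'))) (β * r * cr) := wrow_of_exp hd hrow (mul_nonneg hβ hr) hρδ
  have hwrowG : WRow g ρ (fun y y' => mG * Real.exp (-(δ * g.dist y y'))) (mG * cr) := wrow_of_exp hd hrow hmG hρδ
  have hwrowS : WRow g ρ (fun y y' => mS * Real.exp (-(δ * g.dist y y'))) (mS * cr) := wrow_of_exp hd hrow hmS hρδ
  have hVX := hasMaj_mulOp_bgSource blk htri hd hrow hσ hρ hρδ hβ hr hG hS hc hq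
  have hZ := hasMaj_bgSource blk htri hd hrow hσ hρ hρδ hβ hr hG hS hc hq
  have hDV := hasMaj_sandwich_blockAvg blk π htri hd hrow hρ hρδ hβ hAX ho hG' hZ hosc
  obtain ⟨M₀, hM₀, hap⟩ := exists_const_hasMaj_ofBlocks (g := g) blk (blk ∘ π)
    (idef (pull π) (pull π) (bgSource G' S' c') (bgSource G S (blockAvg π c')))
  have hq2 : (BlockNorm.ofBlocks g (blk ∘ π)).κ * (β * r * cr) < 1 := by rw [kappa_ofBlocks, one_mul]; exact hq
  have key := idef_source_step_majorant (b₁ := BlockNorm.ofBlocks g blk) (b₂' := BlockNorm.ofBlocks g (blk ∘ π))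
    (τ₁ := pull π) (τ₂ := pull π) (S := S) (G₁ := G) (Xc := bgSource G S (blockAvg π c')) (V := mulOp (blockAvg π c')) (S' := S') (G₁' := G')
    (Xf := bgSource G' S' c') (V' := mulOp c') (w := fun _ => (1 : ℝ)) (ρ := ρ) (σ := 0) (C := 1) htri hd hρ (fun _ => zero_le_one)
    (slowWeight_const 1) zero_le_one (mul_nonneg hr hAX) (mul_nonneg (mul_nonneg (mul_nonneg hβ ho) hAX) hcr) hM₀
    (fun _ _ => mul_nonneg (mul_nonneg hβ hr) (Real.exp_nonneg _)) hwrow' (fun _ _ => mul_nonneg hmS (Real.exp_nonneg _)) hwrowS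
    (fun _ _ => mul_nonneg hmG (Real.exp_nonneg _)) hwrowG hfix hfix' hK' (by simpa only [add_zero] using hVX)
    (by simpa only [mul_one] using hDS) (by simpa only [mul_one] using hDG) (by simpa only [mul_one] using hDV) (by simpa only [mul_one] using hap) hq2
  refine key.mono fun a b => le_of_eq ?_
  rfl

/-- **ENTRIES 1∕3 — THE η-DEFECT OF A DERIVED OBJECT.**  Data of A1's `hasMaj_idef_bgProp` plus a `U ≡ 1` DERIVED PAIR `D`, `D′ ≤ β·e^{−δd}` with defect
`𝔇(D′, D) ≤ m_D·e^{−δd}`: `𝔇(bgDerived G′ D′ c′, bgDerived G D (blockAvg π c′)) ≤ (m_D c_r + m_D c_r·A_V + βrc_r·c_X + βo·β(1−q)⁻¹c_r)·e^{−ρd}` with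
`A_V = rβ(1−q)⁻¹` and `c_X` = A1's entry-0 constant — file 7 `idef_derived_entry_majorant_flat` with binders (c) VX, the fine `D′∘M_{c′}`, the entry-0
defect and the sandwich ALL DISCHARGED (zeroth-order species: the sandwich needs only `D′`'s plain majorant). [cite: Balaban1985BackgroundPropagators, Thm 3.1 (3.42) p.397 (second and fourth entries: shapes); King1986, Prop. 3.9 (3.73) p.665 (separate derivative kernel: shape)] -/
theorem hasMaj_idef_bgDerived (htri : Triangle254 g) (hd : ∀ a b : g.Site, 0 ≤ g.dist a b) {σ cr : ℝ} (hσ : 0 ≤ σ) (hcr : 0 ≤ cr)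
    (hrow : RowSum g σ cr) {ρ δ β r o mG mD : ℝ} (hρ : 0 ≤ ρ) (hρδ : ρ + σ ≤ δ) (hβ : 0 ≤ β) (hr : 0 ≤ r) (ho : 0 ≤ o) (hmG : 0 ≤ mG) (hmD : 0 ≤ mD)
    {G D : (X → ℝ) →ₗ[ℝ] (X → ℝ)} {G' D' : (X' → ℝ) →ₗ[ℝ] (X' → ℝ)} {c' : X' → ℝ}
    (hG : HasMaj (BlockNorm.ofBlocks g blk) (BlockNorm.ofBlocks g blk) G (fun y y' => β * Real.exp (-(δ * g.dist y y'))))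
    (hG' : HasMaj (BlockNorm.ofBlocks g (blk ∘ π)) (BlockNorm.ofBlocks g (blk ∘ π)) G' (fun y y' => β * Real.exp (-(δ * g.dist y y'))))
    (hD' : HasMaj (BlockNorm.ofBlocks g (blk ∘ π)) (BlockNorm.ofBlocks g (blk ∘ π)) D' (fun y y' => β * Real.exp (-(δ * g.dist y y'))))
    (hDG : HasMaj (BlockNorm.ofBlocks g blk) (BlockNorm.ofBlocks g (blk ∘ π)) (idef (pull π) (pull π) G' G)
      (fun y y' => mG * Real.exp (-(δ * g.dist y y'))))
    (hDD : HasMaj (BlockNorm.ofBlocks g blk) (BlockNorm.ofBlocks g (blk ∘ π)) (idef (pull π) (pull π) D' D)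
      (fun y y' => mD * Real.exp (-(δ * g.dist y y'))))
    (hc' : ∀ x', |c' x'| ≤ r) (hosc : FibreOsc π c' (fun _ => o)) (hq : β * r * cr < 1) :
    HasMaj (BlockNorm.ofBlocks g blk) (BlockNorm.ofBlocks g (blk ∘ π))
      (idef (pull π) (pull π) (bgDerived G' D' c') (bgDerived G D (blockAvg π c')))
      (fun y y' => (mD * cr + 1 * (mD * cr) * (r * (β * (1 - β * r * cr)⁻¹)) +
          1 * (β * r * cr) * ((mG * cr + 1 * (mG * cr) * (r * (β * (1 - β * r * cr)⁻¹)) + β * o * (β * (1 - β * r * cr)⁻¹) * cr) *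
            (1 - 1 * (β * r * cr))⁻¹) + β * o * (β * (1 - β * r * cr)⁻¹) * cr) * Real.exp (-(ρ * g.dist y y'))) := by
  have hσδ : σ ≤ δ := by linarith
  have hc : ∀ x, |blockAvg π c' x| ≤ r := abs_blockAvg_le π hr hc'
  have hq' : 0 < 1 - β * r * cr := by linarith
  have hAX : 0 ≤ β * (1 - β * r * cr)⁻¹ := mul_nonneg hβ (inv_nonneg.2 hq'.le)
  have hwrowD : WRow g ρ (fun y y' => mD * Real.exp (-(δ * g.dist y y'))) (mD * cr) := wrow_of_exp hd hrow hmD hρδ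
  have hDV' := hasMaj_step (blk ∘ π) hβ hr hD' hc'
  have hwrow' : WRow g ρ (fun y y' => β * r * Real.exp (-(δ * g.dist y y'))) (β * r * cr) := wrow_of_exp hd hrow (mul_nonneg hβ hr) hρδ
  have hVX := hasMaj_mulOp_bgProp blk htri hd hrow hσ hρ hρδ hβ hr hG hc hq
  have hX := hasMaj_bgProp blk htri hd hrow hσ hρ hρδ hβ hr hG hc hq
  have hDX := hasMaj_idef_bgProp blk π htri hd hσ hcr hrow hρ hρδ hβ hr ho hmG hG hG' hDG hc' hosc hq
  have hsand := hasMaj_sandwich_blockAvg blk π htri hd hrow hρ hρδ hβ hAX ho hD' hX hosc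
  have hcX : 0 ≤ (mG * cr + 1 * (mG * cr) * (r * (β * (1 - β * r * cr)⁻¹)) + β * o * (β * (1 - β * r * cr)⁻¹) * cr) *
      (1 - 1 * (β * r * cr))⁻¹ := by
    have h1 : 0 ≤ (1 - 1 * (β * r * cr))⁻¹ := inv_nonneg.2 (by linarith)
    have h2 : 0 ≤ (1 - β * r * cr)⁻¹ := inv_nonneg.2 hq'.le
    positivity
  have key := idef_derived_entry_majorant_flat (b₁ := BlockNorm.ofBlocks g blk) (b₂' := BlockNorm.ofBlocks g (blk ∘ π))
    (b₃' := BlockNorm.ofBlocks g (blk ∘ π)) (pull π) (pull π) (pull π) (D₁ := D) (Y := bgDerived G D (blockAvg π c')) (V := mulOp (blockAvg π c'))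
    (Xc := bgProp G (blockAvg π c')) (D₁' := D') (Y' := bgDerived G' D' c') (V' := mulOp c') (Xf := bgProp G' c') (ρ := ρ) htri hρ
    (mul_nonneg hr hAX) hcX (fun _ _ => mul_nonneg hmD (Real.exp_nonneg _)) hwrowD
    (fun _ _ => mul_nonneg (mul_nonneg hβ hr) (Real.exp_nonneg _)) hwrow' rfl rfl hDD hVX hDV' hDX hsand
  refine key.mono fun a b => le_of_eq ?_
  rfl

end Majorants

/-! ## §3 Under the guard: entries 2 and 1∕3 with the letters read off `Reg335` -/

section Guard

variable {X X' : Type} [Fintype X] [Fintype X'] [DecidableEq X] [DecidableEq X'] {g : B6.Geometry} (blk : X → g.Site) (π : X' → X)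

/-- THE EXPLICIT CONSTANT of entries 1∕3 under the guard: `m₀c_r + m₀c_r(c₃₅a₀)(2β) + bgConst∕2 + β(c₃₅a₀)(2β)c_r`. [folklore] -/
def bgConst1 (β cr m₀ c35 a₀ : ℝ) : ℝ :=
  m₀ * cr + m₀ * cr * (c35 * a₀ * (β * 2)) + bgConst β cr m₀ c35 a₀ / 2 + β * (c35 * a₀) * (β * 2) * cr

/-- The constant is non-negative for non-negative letters. [folklore] -/
theorem bgConst1_nonneg {β cr m₀ c35 a₀ : ℝ} (hβ : 0 ≤ β) (hcr : 0 ≤ cr) (hm₀ : 0 ≤ m₀) (hc35 : 0 ≤ c35) (ha₀ : 0 ≤ a₀) :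
    0 ≤ bgConst1 β cr m₀ c35 a₀ := by
  have := bgConst_nonneg hβ hcr hm₀ hc35 ha₀
  unfold bgConst1; positivity

/-- The entry-0∕2 polynomial under the guard: `(m c_r + m c_r·(rβu) + β(rθ)·(βu)·c_r)·u ≤ bgConst·θ` for `m = m₀θ`, `r ≤ c₃₅a₀`, `u ≤ 2`. [folklore] -/
theorem poly0_le {β cr m₀ θ c35 a₀ r u : ℝ} (hβ : 0 ≤ β) (hcr : 0 ≤ cr) (hm₀ : 0 ≤ m₀) (hθ : 0 ≤ θ) (hr : 0 ≤ r) (hra : r ≤ c35 * a₀)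
    (hu0 : 0 ≤ u) (hu : u ≤ 2) :
    (m₀ * θ * cr + m₀ * θ * cr * (r * (β * u)) + β * (r * θ) * (β * u) * cr) * u ≤ bgConst β cr m₀ c35 a₀ * θ := by
  have hca : 0 ≤ c35 * a₀ := hr.trans hra
  calc (m₀ * θ * cr + m₀ * θ * cr * (r * (β * u)) + β * (r * θ) * (β * u) * cr) * u
      ≤ (m₀ * θ * cr + m₀ * θ * cr * (c35 * a₀ * (β * 2)) + β * (c35 * a₀ * θ) * (β * 2) * cr) * 2 := by gcongr
    _ = bgConst β cr m₀ c35 a₀ * θ := by unfold bgConst; ring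

/-- **ENTRY 2 UNDER THE GUARD**: `𝔇(bgSource G′ S′ c′, bgSource G S (blockAvg π c′)) ≤ bgConst·θ·e^{−(δ−σ)d}` for every `Reg335`-regular `c′` under
`M ≥ 1`, `α₀ > 0`, `M·α₀ ≤ a₀`, `β(c₃₅a₀)c_r ≤ ½`. [cite: Balaban1985BackgroundPropagators, Thm 3.1 p.397 (quantifier template); (3.63)–(3.65) pp.402–403 (mechanism)] -/
theorem hasMaj_entry2_background (htri : Triangle254 g) (hd : ∀ a b : g.Site, 0 ≤ g.dist a b) {σ cr : ℝ} (hσ : 0 ≤ σ) (hcr : 0 ≤ cr)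
    (hrow : RowSum g σ cr) {δ β m₀ θ c35 a₀ M α₀ : ℝ} (hσδ : σ ≤ δ) (hβ : 0 ≤ β) (hm₀ : 0 ≤ m₀) (hθ : 0 ≤ θ) (hc35 : 0 < c35)
    (hq : β * (c35 * a₀) * cr ≤ 1 / 2) (hM : 1 ≤ M) (hα₀ : 0 < α₀) (hMα : M * α₀ ≤ a₀)
    {G S : (X → ℝ) →ₗ[ℝ] (X → ℝ)} {G' S' : (X' → ℝ) →ₗ[ℝ] (X' → ℝ)}
    (hG : HasMaj (BlockNorm.ofBlocks g blk) (BlockNorm.ofBlocks g blk) G (fun y y' => β * Real.exp (-(δ * g.dist y y'))))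
    (hG' : HasMaj (BlockNorm.ofBlocks g (blk ∘ π)) (BlockNorm.ofBlocks g (blk ∘ π)) G' (fun y y' => β * Real.exp (-(δ * g.dist y y'))))
    (hS : HasMaj (BlockNorm.ofBlocks g blk) (BlockNorm.ofBlocks g blk) S (fun y y' => β * Real.exp (-(δ * g.dist y y'))))
    (hDG : HasMaj (BlockNorm.ofBlocks g blk) (BlockNorm.ofBlocks g (blk ∘ π)) (idef (pull π) (pull π) G' G)
      (fun y y' => m₀ * θ * Real.exp (-(δ * g.dist y y'))))
    (hDS : HasMaj (BlockNorm.ofBlocks g blk) (BlockNorm.ofBlocks g (blk ∘ π)) (idef (pull π) (pull π) S' S)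
      (fun y y' => m₀ * θ * Real.exp (-(δ * g.dist y y'))))
    {c' : X' → ℝ} (hreg : (coeffBg π M θ).Reg335 c35 α₀ c') :
    HasMaj (BlockNorm.ofBlocks g blk) (BlockNorm.ofBlocks g (blk ∘ π))
      (idef (pull π) (pull π) (bgSource G' S' c') (bgSource G S (blockAvg π c')))
      (fun y y' => bgConst β cr m₀ c35 a₀ * θ * Real.exp (-((δ - σ) * g.dist y y'))) := by
  obtain ⟨hsup, hosc⟩ := (reg335_coeffBg_iff π M θ c35 α₀ c').1 hreg
  set r : ℝ := c35 * M * α₀ with hr_def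
  have hM0 : 0 ≤ M := zero_le_one.trans hM
  have hr0 : 0 ≤ r := by positivity
  have hra : r ≤ c35 * a₀ := by rw [hr_def, mul_assoc]; exact mul_le_mul_of_nonneg_left hMα hc35.le
  have hq' : β * r * cr ≤ 1 / 2 := (mul_le_mul_of_nonneg_right (mul_le_mul_of_nonneg_left hra hβ) hcr).trans hq
  have hq1 : β * r * cr < 1 := by linarith
  have hinv : (1 - β * r * cr)⁻¹ ≤ 2 := inv_one_sub_le_two hq'
  have hinv0 : 0 ≤ (1 - β * r * cr)⁻¹ := inv_nonneg.2 (by linarith)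
  have hosc' : FibreOsc π c' (fun _ => r * θ) := by simpa only [hr_def] using hosc
  have key := hasMaj_idef_bgSource blk π htri hd hσ hcr hrow (ρ := δ - σ) (by linarith) (by linarith) hβ hr0 (mul_nonneg hr0 hθ)
    (mul_nonneg hm₀ hθ) (mul_nonneg hm₀ hθ) hG hG' hS hDG hDS hsup hosc' hq1
  refine key.mono fun a b => ?_
  simp only [one_mul, mul_one]
  exact mul_le_mul_of_nonneg_right (poly0_le hβ hcr hm₀ hθ hr0 hra hinv0 hinv) (Real.exp_nonneg _)

/-- **ENTRIES 1∕3 UNDER THE GUARD**: `𝔇(bgDerived G′ D′ c′, bgDerived G D (blockAvg π c′)) ≤ bgConst1·θ·e^{−(δ−σ)d}` for every `Reg335`-regular `c′` under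
the guard. [cite: Balaban1985BackgroundPropagators, Thm 3.1 p.397 (quantifier template); King1986, Prop. 3.9 (3.73) p.665 (shape)] -/
theorem hasMaj_entry13_background (htri : Triangle254 g) (hd : ∀ a b : g.Site, 0 ≤ g.dist a b) {σ cr : ℝ} (hσ : 0 ≤ σ) (hcr : 0 ≤ cr)
    (hrow : RowSum g σ cr) {δ β m₀ θ c35 a₀ M α₀ : ℝ} (hσδ : σ ≤ δ) (hβ : 0 ≤ β) (hm₀ : 0 ≤ m₀) (hθ : 0 ≤ θ) (hc35 : 0 < c35) (ha₀ : 0 ≤ a₀)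
    (hq : β * (c35 * a₀) * cr ≤ 1 / 2) (hM : 1 ≤ M) (hα₀ : 0 < α₀) (hMα : M * α₀ ≤ a₀)
    {G D : (X → ℝ) →ₗ[ℝ] (X → ℝ)} {G' D' : (X' → ℝ) →ₗ[ℝ] (X' → ℝ)}
    (hG : HasMaj (BlockNorm.ofBlocks g blk) (BlockNorm.ofBlocks g blk) G (fun y y' => β * Real.exp (-(δ * g.dist y y'))))
    (hG' : HasMaj (BlockNorm.ofBlocks g (blk ∘ π)) (BlockNorm.ofBlocks g (blk ∘ π)) G' (fun y y' => β * Real.exp (-(δ * g.dist y y'))))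
    (hD' : HasMaj (BlockNorm.ofBlocks g (blk ∘ π)) (BlockNorm.ofBlocks g (blk ∘ π)) D' (fun y y' => β * Real.exp (-(δ * g.dist y y'))))
    (hDG : HasMaj (BlockNorm.ofBlocks g blk) (BlockNorm.ofBlocks g (blk ∘ π)) (idef (pull π) (pull π) G' G)
      (fun y y' => m₀ * θ * Real.exp (-(δ * g.dist y y'))))
    (hDD : HasMaj (BlockNorm.ofBlocks g blk) (BlockNorm.ofBlocks g (blk ∘ π)) (idef (pull π) (pull π) D' D)
      (fun y y' => m₀ * θ * Real.exp (-(δ * g.dist y y'))))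
    {c' : X' → ℝ} (hreg : (coeffBg π M θ).Reg335 c35 α₀ c') :
    HasMaj (BlockNorm.ofBlocks g blk) (BlockNorm.ofBlocks g (blk ∘ π))
      (idef (pull π) (pull π) (bgDerived G' D' c') (bgDerived G D (blockAvg π c')))
      (fun y y' => bgConst1 β cr m₀ c35 a₀ * θ * Real.exp (-((δ - σ) * g.dist y y'))) := by
  obtain ⟨hsup, hosc⟩ := (reg335_coeffBg_iff π M θ c35 α₀ c').1 hreg
  set r : ℝ := c35 * M * α₀ with hr_def
  have hM0 : 0 ≤ M := zero_le_one.trans hM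
  have hr0 : 0 ≤ r := by positivity
  have hra : r ≤ c35 * a₀ := by rw [hr_def, mul_assoc]; exact mul_le_mul_of_nonneg_left hMα hc35.le
  have hca : 0 ≤ c35 * a₀ := hr0.trans hra
  have hq' : β * r * cr ≤ 1 / 2 := (mul_le_mul_of_nonneg_right (mul_le_mul_of_nonneg_left hra hβ) hcr).trans hq
  have hq0 : 0 ≤ β * r * cr := by positivity
  have hq1 : β * r * cr < 1 := by linarith
  have hinv : (1 - β * r * cr)⁻¹ ≤ 2 := inv_one_sub_le_two hq'
  have hinv0 : 0 ≤ (1 - β * r * cr)⁻¹ := inv_nonneg.2 (by linarith)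
  have hosc' : FibreOsc π c' (fun _ => r * θ) := by simpa only [hr_def] using hosc
  have key := hasMaj_idef_bgDerived blk π htri hd hσ hcr hrow (ρ := δ - σ) (by linarith) (by linarith) hβ hr0 (mul_nonneg hr0 hθ)
    (mul_nonneg hm₀ hθ) (mul_nonneg hm₀ hθ) hG hG' hD' hDG hDD hsup hosc' hq1
  refine key.mono fun a b => ?_
  simp only [one_mul]
  refine mul_le_mul_of_nonneg_right ?_ (Real.exp_nonneg _)
  -- the entry-0 polynomial inside is `≤ bgConst·θ` (`poly0_le`) with coefficient `βrc_r ≤ ½`; the rest is monotone in `r ≤ c₃₅a₀`, `u ≤ 2`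
  set u : ℝ := (1 - β * r * cr)⁻¹ with hu_def
  have h0 := poly0_le hβ hcr hm₀ hθ hr0 hra hinv0 hinv
  have h2 : m₀ * θ * cr * (r * (β * u)) ≤ m₀ * θ * cr * (c35 * a₀ * (β * 2)) := by gcongr
  have h3 : β * r * cr * ((m₀ * θ * cr + m₀ * θ * cr * (r * (β * u)) + β * (r * θ) * (β * u) * cr) * u) ≤
      1 / 2 * (bgConst β cr m₀ c35 a₀ * θ) := mul_le_mul hq' h0 (by positivity) (by norm_num)
  have h4 : β * (r * θ) * (β * u) * cr ≤ β * (c35 * a₀ * θ) * (β * 2) * cr := by gcongr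
  calc m₀ * θ * cr + m₀ * θ * cr * (r * (β * u)) +
        β * r * cr * ((m₀ * θ * cr + m₀ * θ * cr * (r * (β * u)) + β * (r * θ) * (β * u) * cr) * u) + β * (r * θ) * (β * u) * cr
      ≤ m₀ * θ * cr + m₀ * θ * cr * (c35 * a₀ * (β * 2)) + 1 / 2 * (bgConst β cr m₀ c35 a₀ * θ) + β * (c35 * a₀ * θ) * (β * 2) * cr :=
        add_le_add (add_le_add (add_le_add le_rfl h2) h3) h4
    _ = bgConst1 β cr m₀ c35 a₀ * θ := by unfold bgConst1; ring

end Guard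

end Summit.QuantumFields.YangMills.BalabanUVNodes.N15.BackgroundLayer
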